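import Summits.QuantumFields.BalabanUV.T4Continuum.Support.NE9CurChartTowerPiLatticeUniformClassW80
import Summits.QuantumFields.BalabanUV.T4Continuum.Support.NE9KerChartCauchyTower

/-!
# NE9KerChartCauchyTowerPiLatticeUniformW80 — THE DECAY-FREE CAUCHY CORE OF THE KERNEL SPECIES `ker U` AT THE k-LEVEL `cur U` CHART OF PRINT's OPERATOR
# (3.122) WITH ONE CAUCHY RADIUS FOR EVERY HEIGHT, SPACING, PERIOD AND UNITARY BACKGROUND OF PRINT's SMALL-FIELD CLASS: (F) `Support/NE9KerChartCauchyTower`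
# §1 `kerCauchy_of_chart` (the three decay-free rows from (Ψ1)(Ψ2) of ANY chart) RE-INSTANTIATED at this seat's `Support/NE9CurChartTowerPiLatticeUniformClassW80`
# (I-7-W80) — whose radii `R_b, R′` precede `∀ n η m U`, so every Cauchy radius `0 < r < R_b` and every constant `M·(N∕r)ᴺ` of [Balaban1987RG1] (4.22)'s
# analyticity factor is chosen BEFORE the lattice; cell `pub-balaban`, T4-DAG §2 node U3 ∕ §6 NE9, WALL-NE9-P1 §3 (ii)∕(vii) (MODEL item O-NE9-1 (ii) «the
# kernel species `ker`»); NE9 crux-team (2) leaf prover 01 (`b2b-balaban-t4-ne9-formalise-leaf-01`, gen 97); Summits-side NEW sibling leaf under this seat's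
# INTERFACE REQUEST NE9 [NE9LEAF01-G96-IFR] (HOME/INBOX.md L.74921; ruling e34b3e0c (0)); nothing printed asserted.  W80 VARIANT (gen 97): the (L3) `W`-slot is the CONCRETE
(80)-current `W80 ρc τc U H̃_{1,k} C_k ε_C J Δπ` of `Literature.….B11Eq80Current`, whose (98)-letter `C₄` and radius `R′` are LATTICE-FREE by
`Literature.….B11Ineq98W80LatticeFree.exists_quadAnalytic_W80_latticeFree` (kernel route (73)→(86)); the chart is (I-7-W80)
`Support/NE9CurChartTowerPiLatticeUniformClassW80.cur_chart_exists_tower_pi_of_unitary_class_lattice_uniform_W80`; otherwise verbatim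

HONEST FRAMING (T4-DAG PAGE 1).  Rung (B)+1 of the FINITE-VOLUME T⁴ programme — NOT infinite volume, NOT a mass gap, NOT the Clay problem.  NE9
(`T4OutputRate.NE9` ∧ `FadingMemory`) is a cell NEW ESTIMATE, NOT PRINTED in [I] = [Balaban1987RG1] (CMP **109**) ∕ [II] = [Balaban1988RG2Cluster]
(CMP **116**), NOT PROVED here («NE9 ⇐ the named binders»; spine PROVED 0∕9).  HONEST DEPENDENCY (cell line, verbatim): continuum YM on T⁴ ⇐
BetaPertH ∧ nine spine estimates (0/9 proved); BetaPertH ⇐ (D1) ∧ (D4) ∧ CAP+tail; G-an2-4 gates asym, D1 and NE2/3/4.  The kernel species `ker`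
is ONE field of the MODEL O-NE9-1 (ii); its binder (K) `kerBound` = DECAY × ANALYTICITY ([I] (4.5) p. 282, (4.22) p. 286).  THIS FILE IS THE ANALYTICITY
FACTOR with a lattice-free Cauchy radius; the decay factor ([Balaban1985Variational] (189)–(190)) is NOT here; `act` and NEEDS-COORDINATOR #5 untouched.

WHAT THIS FILE PROVES (ONE theorem; 0 def, 0 sorry, axioms standard; [folklore] composition BY NAME).  **`kerCauchy_tower_pi_of_unitary_class_lattice_uniform_W80`**
— (I-7)'s `∃ α₁ j₁ ε₄ ε_C R_b R′` BEFORE `∀ n η m U …` and its per-lattice `∃ h52 hpos′ hposπ` KEPT; then for EVERY map `Φ` that agrees with the chart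
`chartHB 𝔊̃_k 0 (W80 ρc τc U H̃_{1,k} C_k ε_C J Δπ) 0 (A′ ↦ A′ + solA H̃_{1,k} 0 C_k 0 ε_C A′) ε₄ H̃_{1,k}` (print's operator at the geometric per-level profile, `QkW_surjective`): the triple
(Ψ1)–(Ψ3) for `Φ`, AND for every old term `F` holomorphic on `ball 0 R′` with `‖F‖ ≤ M` and every `0 < r < R_b` the three decay-free rows —
`‖Dᴺ(F ∘ Φ)(0)‖ ≤ M(N∕r)ᴺ`, the every-index-tuple kernel bound `‖𝐄⁽ᴺ⁾(xs)[b]‖ ≤ M(N∕r)ᴺ∏‖b_k‖`, the volume-free bilocalized `(p, q)` bound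
([Balaban1987RG1] (4.2)–(4.5), (4.19)–(4.22) p. 286).  Since `R_b` precedes the lattice, `r := R_b∕2` (say) is ONE Cauchy radius for the whole tower and class.
DISGUISE TEST: composition of two landed theorems; no inequality of the series proved; print's class, the diagonal bookkeeping, the weight-profile bounds and
the (L3) `W` stay DISPLAYED; NOT the decay factor, NOT the two-background chart, NOT claimed that Bałaban's 𝐇_k ∕ old terms meet these letters (O-NE9-1; #5
UNRULED); `ker` NOT constructed; not NE9.
References (TYPES ∕ loci only): [Balaban1987RG1] (4.2)–(4.5) p. 282, (4.19)–(4.22) p. 286; [Balaban1985Variational] (103) p. 293, Prop. 6 (117)–(121) p. 295,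
(172)–(175) p. 305; [Balaban1985BackgroundPropagators] (3.35)–(3.37) p. 396, (3.122) p. 420, Thm 3.12 p. 423, Thm 3.13 p. 426; [Balaban1985Averaging] Prop. 2 p. 26.
-/

noncomputable section

open Metric Set Finset

namespace Summit.QuantumFields.BalabanUV.T4Continuum.NE9KerChartCauchyTowerPiLatticeUniformW80

open scoped InnerProductSpace ComplexConjugate BigOperators
open Literature.MathematicalPhysics.QuantumFieldTheory.Balaban1983to89
open B11Eq103H1Complex B11Eq115Space B11Eq174Chart
open B11Eq111FrakG (nabla115)
open B13Contraction113 (QuadAnalytic)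
open B9SectCLatticeCarrier (Bond bpos btgt unshift)
open B4Sect5Torus (TSite)
open B7Prop1Explicit (U1 Wcx boxVec)
open B7Prop2Explicit (pdev AvgClosed C0 c2' unitaryUnits avgClosed_unitaryUnits unitaryUnits_le_U1)
open B7Prop3Flat (c3)
open B9Eq315QTorus (perCfg cornerSite)
open B9Eq315QTower (towerP UlevOf)
open B9Eq326OperatorTower (QkW QkW_surjective laplaceAk)
open B9Eq310HessianOperator (adTransportW)
open B9Eq310DeltaPrime (plaqHolU)
open B9Eq324DeltaPrimeATower (laplacePrimeAk)
open B9Eq3119DeltaPiTower (laplaceAkPi)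
open B11Eq44COperatorTower (αT αT_le ulev_mem_U1_of_pdev)
open B11Eq44COperatorTowerGeometric (ulev_reg_of_pdev_geometric geomProfile_nonneg geomProfile_le_αT sum_geomProfile_le)
open B11Eq44CLetterTower (Cck)
open B9Thm311SmallFieldClosed (hRS_of_unitary)
open B9Eq315QTorusOnto (liftSite perSite_liftSite)
open B7Eq43AveragedSmallnessLevelFree (pdev_perCfg_le_of_plaq)
open B7Eq43AveragedSmallnessLinearFeed (twoWindows_linear_feed)
open B9Thm311SitePrimeFormCoerciveTowerCanonical (exists_strong_site_coercive_tower_diagonal)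
open B9Thm311LaplaceAkPiPositiveDiagonal (exists_laplaceAkPi_pos_diagonal_closed)
open B9Thm311LaplaceAkPositiveDiagonal (exists_laplaceAk_pos_diagonal_closed)
open B9Eq326OperatorTowerRealityUnitary (UlevOf_star_eq_inv forall_star_eq_inv_of_mem)
open B9Eq342GreenPrimeSupBound (norm_adTransportW_eq)
open B12Eq419Kernel (kernelE)
open Summit.QuantumFields.BalabanUV.T4Continuum.NE9CurChartTowerPiLatticeUniformClassW80 (cur_chart_exists_tower_pi_of_unitary_class_lattice_uniform_W80)
open B11Eq80Current (W80)
open B11Eq63V0GroupCurrent (curV0)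
open B11Eq44CLetterTower (Cck)
open Summit.QuantumFields.BalabanUV.T4Continuum.NE9KerChartCauchyTower (kerCauchy_of_chart)

variable {d : ℕ} (hd : 1 ≤ d) (L : ℕ) [NeZero L] (hL : 1 ≤ L) (hL2 : 2 ≤ L) (hL3 : 3 ≤ L) [Fact (0 < (L : ℝ))]
  {𝔸 : Type*} [CStarAlgebra 𝔸] [Nontrivial 𝔸] [FiniteDimensional ℂ 𝔸]
  {W : Type*} [NormedAddCommGroup W] [InnerProductSpace ℂ W] [FiniteDimensional ℂ W] (φ : W ≃ₗ[ℂ] 𝔸)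
  {Mφ Mφ' : ℝ} (hMφ : 0 ≤ Mφ) (hMφ' : 0 ≤ Mφ') (hφ : ∀ w, ‖φ w‖ ≤ Mφ * ‖w‖) (hφ' : ∀ X, ‖φ.symm X‖ ≤ Mφ' * ‖X‖)
  {a : ℝ} (ha : 0 < a) {a' : ℝ} (ha' : 0 < a')
  (τ : 𝔸 →ₗ[ℂ] ℂ) {Cτ : ℝ} (hτ : ∀ X, ‖τ X‖ ≤ Cτ * ‖X‖) (hCτ : 0 ≤ Cτ) {Mτ : ℝ} (hτm : ∀ X Y : 𝔸, ‖τ (X * Y)‖ ≤ Mτ * ‖X‖ * ‖Y‖) (hMτ : 0 ≤ Mτ)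
  {ρw : ℝ} (hρw : 0 ≤ ρw)
  (hτ₁ : ∀ X : 𝔸, τ (star X) = conj (τ X)) (hτ₂ : ∀ X Y : 𝔸, τ (X * Y) = τ (Y * X)) (hφτ : ∀ X Y : 𝔸, ⟪φ.symm X, φ.symm Y⟫_ℂ = τ (star X * Y))
  {α₀ : ℝ} (hα₀ : 0 < α₀) (hα3 : C0 d * α₀ ≤ 1 / 3) (hα4 : 4 * α₀ ≤ c2' d L)
  (hαL : 50 * (d + 1) * αT d L α₀ * (L : ℝ) ^ d ≤ 1 / 2)
  {ρ : ℝ} (hρ0 : 0 < ρ) (hρ : Real.exp (4 * (800 * ((d : ℝ) + 1) ^ 2 * ((d : ℝ) + 4)) * α₀) * (1 + 8 * (131072 * ((d : ℝ) + 1) ^ 2) * ρ) ≤ 2)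
  (hρ4 : 4 * ρ ≤ c3 d L) (hθ : 2 * d * B7Prop5GeneralLevels.thetaGen d L α₀ ≤ (L : ℝ) ^ 3 / 16) (hC3 : 2 * d * B7Prop5GeneralLevels.C3Gen d L * ρ ≤ 1)
  {CV RV Mr Mt MJ MΔ : ℝ} (hCV : 0 ≤ CV) (hRV : 0 < RV) (hMr : 0 ≤ Mr) (hMt : 0 ≤ Mt) (hMJ : 0 ≤ MJ) (hMΔ : 0 ≤ MΔ) {ω Ω : ℝ} (hω : 0 ≤ ω) (hΩ : 0 ≤ Ω)

-- deep definitional unfolding `laplaceAkPi` ↦ `laplaceALatticeK … (π†Δπ) …` in the statement (as the host)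
set_option maxRecDepth 8192 in
set_option maxHeartbeats 1600000 in -- (I-7)'s ≈ 60-binder theorem applied once + the chart term
include hd hL2 hL3 hMφ hMφ' hφ hφ' ha ha' hτ hCτ hτm hMτ hρw hτ₁ hτ₂ hφτ hα₀ hα3 hα4 hαL hρ0 hρ hρ4 hθ hC3 hω hΩ hCV hRV hMr hMt hMJ hMΔ in
/-- **THE K-CORE OF `ker U` AT THE LATTICE-UNIFORM k-LEVEL CHART ON PRINT's CLASS** — (I-7) KEPT (`∃` radii before the lattice, `∃ h52 hpos′ hposπ` per lattice),
read at every `Φ` agreeing with the chart: (Ψ1)–(Ψ3) for `Φ` AND, for every old term `F` holomorphic on `ball 0 R′` bounded by `M` and every `0 < r < R_b`,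
the three decay-free Cauchy rows of (F) `kerCauchy_of_chart`. [folklore]
[cite: Balaban1987RG1, (4.2)–(4.5) p.282, (4.19)–(4.22) p.286; Balaban1985BackgroundPropagators, (3.122) p.420, (3.35)–(3.37) p.396, Thm 3.13 p.426; Balaban1985Variational, (103) p.293, Prop. 6 (117)–(121) p.295, (172)–(175) p.305] -/
theorem kerCauchy_tower_pi_of_unitary_class_lattice_uniform_W80 {X : Type*} [NormedAddCommGroup X] [NormedSpace ℂ X] [CompleteSpace X] :
    ∃ α₁ j₁ ε₄ εC Rb R' : ℝ, 0 < α₁ ∧ 0 < j₁ ∧ 0 < Rb ∧ 0 < R' ∧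
      ∀ (n : ℕ) (η : ℝ) [Fact (0 < η)] (hηL : η * (L : ℝ) ^ (n + 1) = 1) (c₀ c₁ : ℝ) [Fact (0 < c₀)] [Fact (0 < c₁)]
        (_hw : c₀ * ((L : ℝ) ^ (n + 1)) ^ d = c₁) (_hc₀η : c₀ = η ^ d) (_hρ : |η| ^ d / c₀ ≤ ρw) (m : Fin d → ℕ) [∀ i, NeZero (m i)] (_hm : ∀ i, 1 ≤ m i)
        (U : Bond d (towerP L m (n + 1)) → 𝔸ˣ) (hUG : ∀ (x : B7Prop1Explicit.Site d) (κ : Fin d), perCfg (towerP L m (n + 1)) U x κ ∈ unitaryUnits 𝔸)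
        (α : ℝ) (_hα : 0 ≤ α) (_hαle : α ≤ α₁) (_hUη : ∀ b, ‖(U b : 𝔸) - 1‖ ≤ α * η)
        (_hpl : ∀ p : B9SectCLatticeCarrier.Plaq d (towerP L m (n + 1)), ‖(plaqHolU U p : 𝔸) - 1‖ ≤ α * η ^ 2)
        (_hUgrad : ∀ (x : TSite d (towerP L m (n + 1))) (μ : Fin d), ‖(U (x, μ) : 𝔸) - U (unshift μ x, μ)‖ ≤ α * η ^ 2)
        (j₀ : ℝ) (_hJ : ∀ μ y, ‖B9Eq39Adjoint.J (fun μ => B9Eq33CovDerivVector.shiftEquiv μ) (fun μ y => U (y, μ)) η μ y‖ ≤ j₀) (_hj : j₀ ≤ j₁)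
        (lev₀ : Bond d (towerP L m (n + 1)) → ℕ) (lev₁ : Bond d (towerP L m (n + 1)) × Fin d → ℕ) (levB : Bond d m → ℕ) (_hlev : ∀ b, n + 1 ≤ lev₀ b)
        (_hw₀ : (NegSup.wSup (levWeight (L : ℝ) η lev₀ 1) : ℝ) ≤ ω) (_hw₁ : (NegSup.wSup (levWeight (L : ℝ) η lev₁ 2) : ℝ) ≤ ω)
        (_hw₃ : (NegSup.wInvSup (levWeight (L : ℝ) η lev₀ 3) : ℝ) ≤ Ω) (_hwB : (NegSup.wInvSup (levWeight (L : ℝ) η levB 0) : ℝ) ≤ Ω)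
        (ρc : (𝔸 →L[ℂ] ℂ) →L[ℂ] 𝔸) (τc : 𝔸 →L[ℂ] ℂ) (_hρc : ‖ρc‖ ≤ Mr) (_hτc : ‖τc‖ ≤ Mt)
        (_hqV : ∀ Y : Space115 (L : ℝ) η lev₀ lev₁ (nabla115 η U), ‖Y‖ < RV → ‖curV0 (lev₁ := lev₁) (Dc := nabla115 η U) ρc τc U Y‖ ≤ CV * ‖Y‖ ^ 2)
        (J : NegSize (L : ℝ) η lev₀ 3 𝔸) (Δπ : Space115 (L : ℝ) η lev₀ lev₁ (nabla115 η U) →L[ℂ] NegSize (L : ℝ) η lev₀ 3 𝔸) (_hJn : ‖J‖ ≤ MJ) (_hΔn : ‖Δπ‖ ≤ MΔ),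
      ∃ h52 : pdev (perCfg (towerP L m (n + 1)) U) < α₀ * (((L : ℝ) ^ (n + 1))⁻¹) ^ 2,
      ∃ hpos' : ∀ x : SiteL2K ℂ d (towerP L m (n + 1)) c₀ W, x ≠ 0 →
          0 < RCLike.re ⟪x, laplacePrimeAk L m n φ η U a' (c₁ := c₁) x⟫_ℂ,
      ∃ hposπ : ∀ x : BondL2K ℂ d (towerP L m (n + 1)) c₀ W, x ≠ 0 →
          0 < RCLike.re ⟪x, laplaceAkPi L m n φ τ η U a' hpos' hL (fun j => αT d L α₀ * (((L : ℝ) ^ min (j + 1) (n + 1))⁻¹) ^ 2)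
            (fun j => (geomProfile_le_αT (d := d) L (n + 1) hL hα₀.le j).trans (αT_le hL hα4))
            (ulev_mem_U1_of_pdev L m (n + 1) U hL2 (avgClosed_unitaryUnits d L) hUG hα₀ hα3 hα4 h52)
            (ulev_reg_of_pdev_geometric L m (n + 1) U hL2 (avgClosed_unitaryUnits d L) hUG hα₀ hα3 hα4 h52) (c₁ := c₁) a x⟫_ℂ,
      ∀ (Φ : NegSize (L : ℝ) η levB 0 𝔸 → Space115 (L : ℝ) η lev₀ lev₁ (nabla115 η U)),
        Φ = (chartHB (frakGLatticeCLM (lev₀ := lev₀) φ hposπ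
              (QkW_surjective L m n φ U hL _ _ _ _ fun j => le_trans (mul_le_mul_of_nonneg_right (mul_le_mul_of_nonneg_left
                (geomProfile_le_αT (d := d) L (n + 1) hL hα₀.le j) (by positivity)) (by positivity)) hαL) lev₁ (nabla115 η U))
            0 (W80 ρc τc U (H1LatticeCLM (lev₀ := lev₀) (levB := levB) φ hposπ
              (QkW_surjective L m n φ U hL _ _ _ _ fun j => le_trans (mul_le_mul_of_nonneg_right (mul_le_mul_of_nonneg_left
                (geomProfile_le_αT (d := d) L (n + 1) hL hα₀.le j) (by positivity)) (by positivity)) hαL) lev₁ (nabla115 η U))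
              (Cck L m η (n + 1) U lev₀ lev₁ (nabla115 η U) levB) εC J Δπ) 0 (fun A' => A' + solA (H1LatticeCLM (lev₀ := lev₀) (levB := levB) φ hposπ
              (QkW_surjective L m n φ U hL _ _ _ _ fun j => le_trans (mul_le_mul_of_nonneg_right (mul_le_mul_of_nonneg_left
                (geomProfile_le_αT (d := d) L (n + 1) hL hα₀.le j) (by positivity)) (by positivity)) hαL) lev₁ (nabla115 η U)) 0
              (Cck L m η (n + 1) U lev₀ lev₁ (nabla115 η U) levB) 0 εC A') ε₄
            (H1LatticeCLM (lev₀ := lev₀) (levB := levB) φ hposπ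
              (QkW_surjective L m n φ U hL _ _ _ _ fun j => le_trans (mul_le_mul_of_nonneg_right (mul_le_mul_of_nonneg_left
                (geomProfile_le_αT (d := d) L (n + 1) hL hα₀.le j) (by positivity)) (by positivity)) hαL) lev₁ (nabla115 η U))) →
        (DifferentiableOn ℂ Φ (ball (0 : NegSize (L : ℝ) η levB 0 𝔸) Rb) ∧
          MapsTo Φ (ball (0 : NegSize (L : ℝ) η levB 0 𝔸) Rb) (ball (0 : Space115 (L : ℝ) η lev₀ lev₁ (nabla115 η U)) R') ∧ Φ 0 = 0) ∧
        ∀ (F' : Space115 (L : ℝ) η lev₀ lev₁ (nabla115 η U) → X) (M : ℝ), DifferentiableOn ℂ F' (ball 0 R') → (∀ y ∈ ball (0 : Space115 (L : ℝ) η lev₀ lev₁ (nabla115 η U)) R', ‖F' y‖ ≤ M) →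
        ∀ (r : ℝ), 0 < r → r < Rb →
          (∀ N : ℕ, ‖iteratedFDeriv ℂ N (F' ∘ Φ) 0‖ ≤ M * ((N : ℝ) / r) ^ N) ∧
          (∀ (N : ℕ) (xs : Fin N → Bond d m) (b : Fin N → 𝔸),
            ‖kernelE (𝕜 := ℂ) N (F' ∘ Φ ∘ (NegSup.continuousLinearEquiv ℂ (levWeight (L : ℝ) η levB 0) (V := 𝔸)).symm) 0 xs b‖ ≤
              M * ((N : ℝ) / r) ^ N * ∏ k, ‖b k‖) ∧
          (∀ (δB B B' : Bond d m → 𝔸) (p q : Bond d m),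
            ‖∑ x₁, ∑ x₂, kernelE (𝕜 := ℂ) 4 (F' ∘ Φ ∘ (NegSup.continuousLinearEquiv ℂ (levWeight (L : ℝ) η levB 0) (V := 𝔸)).symm) 0 ![p, x₁, x₂, q]
                ![δB p, B x₁, B x₂, B' q]‖ ≤ M * ((4 : ℝ) / r) ^ 4 * (‖δB p‖ * ‖B‖ ^ 2 * ‖B' q‖)) := by
  classical
  obtain ⟨α₁, j₁, ε₄, εC, Rb, R', hα₁, hj₁, hRb0, hR'0, HC⟩ :=
    cur_chart_exists_tower_pi_of_unitary_class_lattice_uniform_W80 hd L hL hL2 hL3 φ hMφ hMφ' hφ hφ' ha ha' τ hτ hCτ hτm hMτ hρw hτ₁ hτ₂ hφτ hα₀ hα3 hα4 hαL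
      hρ0 hρ hρ4 hθ hC3 hω hΩ hCV hRV hMr hMt hMJ hMΔ
  refine ⟨α₁, j₁, ε₄, εC, Rb, R', hα₁, hj₁, hRb0, hR'0, ?_⟩
  intro n η _ hηL c₀ c₁ _ _ hw hc₀η hρ' m _ hm U hUG α hα0 hαle hUη hpl hUgrad j₀ hJ hj' lev₀ lev₁ levB hlev hw₀ hw₁ hw₃ hwB ρc τc hρc' hτc' hqV J Δπ hJn hΔn
  obtain ⟨h52, hpos', hposπ, hΨ1, hΨ2, hΨ3⟩ :=
    HC n η hηL c₀ c₁ hw hc₀η hρ' m hm U hUG α hα0 hαle hUη hpl hUgrad j₀ hJ hj' lev₀ lev₁ levB hlev hw₀ hw₁ hw₃ hwB ρc τc hρc' hτc' hqV J Δπ hJn hΔn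
  refine ⟨h52, hpos', hposπ, fun Φ hΦ => ?_⟩
  subst hΦ
  exact ⟨⟨hΨ1, hΨ2, hΨ3⟩, fun F' M hF hM r hr hrR => kerCauchy_of_chart (L := (L : ℝ)) (η := η) (lev := levB) hΨ1 hΨ2 hF hM hr hrR⟩

end Summit.QuantumFields.BalabanUV.T4Continuum.NE9KerChartCauchyTowerPiLatticeUniformW80

end
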